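import Summits.QuantumFields.YangMills.Theorems.UnitScaleTiltProp7SectET3DeltaPiT3
import Summits.QuantumFields.YangMills.Theorems.UnitScaleTiltProp7SectET3Eq3124RowsT3
import HarnessLib

/-!
# Route `UnitScaleTilt`, crux «MinimiserStabilityRegPr» (stmt-QuantumFields-19200, stub EX) ∕ (O″χ) B0 (stmt-QuantumFields-20520), node N06(d = 3), route (α) —
# LAYER 0, ROWS OF BRICK L0b PART 2 (def-free sibling of `UnitScaleTiltProp7SectET3DeltaPiT3`): **`Δ_π` KILLS THE RESIDUAL PURE GAUGES** — [Balaban1985BackgroundPropagators] p. 419 «The quadratic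
# form is invariant with respect to gauge transformations determined by λ ∈ N(Q′) … the expression A − DG′RD*A has this invariance property» AT THE T³ MEMBER: `(1 − DG′R_SD*)(D_{U₀}λ) = 0`
# and `Δ_π(U₀)(D_{U₀}λ) = 0` for `λ ∈ N_S(U₀)` on the class `PosPrime` — the hypothesis `hΔ` of the (3.124) rows DISCHARGED for `Δx := DeltaPiSlot`, hence **(3.124)₂, «Q𝔊 = 0» and the EX
# binder `h102` for PRINT'S `G`∕`𝔓`-ALGEBRA OF RECORD**, modulo the two positivity classes only

Cell `ym-inputs` (desk `pub/ym-inputs`, INPUT-LIST.md v6 §4 row p01; memo `pub/ym-inputs/DEFINER-MEMO-T3.md` §2 L0e).  THEOREMS ONLY (0 `def`, 0 `sorry`); `--supports stmt-QuantumFields-20520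
--as helper`; count-neutral.  YM₃ on T³ is ladder rung R3, NOT the Clay problem; nothing here is a claim about a stub, a crux, d = 4 or the mass gap.

THE PRINT.  [Balaban1985BackgroundPropagators] (3.118)–(3.119) p. 419 (quoted in the title; «we have used the identity RD*(A − Dλ) = RD*A − RΔλ = RD*A − Δλ, which holds by the definition of R and
the fact that λ ∈ N(Q′)»), (3.124) p. 420; [Balaban1985Variational] (102) p. 293.

WHAT IS PROVED (member `F`, `h : n ≤ K`, parameters `c₀ cB a`; `hq : PosPrime … U₀` = positivity of `Δ′_a` ([B9] p.395 ∕ Thm 3.11, displayed); `hp : PosOnto … DeltaPiSlot U₀`):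
`laplacePrimeA_apply_of_mem_NS` (`Δ′_aλ = Δ^ηλ` on `N_S`), `GprimeT_covLapSite_of_mem_NS` (`G′Δ^ηλ = λ` on `N_S`, on the class), ★`gaugeCorr_DL2_of_mem_NS` (`(1 − DG′R_SD*)(Dλ) = 0`: print's «RD*Dλ = Δλ» via
✓`RS_apply_covLapSite_of_mem`), ★★`DeltaPi_DL2_of_mem_NS` (`Δ_π(Dλ) = 0`), `DeltaPiSlot_kills_NS` (= the `hΔ` of `…SectET3Eq3124RowsT3`), and the instances for the letters of record:
★★`Qk_Gpi_DL2_RS` ((3.124)₂ for print's `G`), ★★`Qk_frakGT_pi` («`Q𝔊 = 0`» for `G𝔓*` at `Δ_π`), ★★★`QTwS_iota_frakGfR_pi` — `h102` VERBATIM (with `QTwS`) for `𝒢f := frakGfR … DeltaPiSlot`, modulo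
`PosOnto ∧ PosPrime` ONLY.
HONEST SCOPE.  Algebra on the classes; no positivity proved; (3.124)₁ and the Landau members still need the self-adjointness row of `Δ^η`; nothing of print asserted.

References: T. Bałaban, CMP **99** (1985) 389–434 [Balaban1985BackgroundPropagators] ((3.118)–(3.119) p.419, (3.124) p.420); CMP **102** (1985) 277–309 [Balaban1985Variational] ((102) p.293).
-/

set_option autoImplicit false

noncomputable section

open scoped InnerProductSpace ComplexConjugate Matrix.Norms.L2Operator

namespace Summit.QuantumFields.YangMills.Theorems.Prop7SectET3DeltaPi

open Literature.MathematicalPhysics.QuantumFieldTheory.Balaban1983to89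
open Literature.MathematicalPhysics.QuantumFieldTheory.Balaban1983to89.T3ContinuumYM3Torus
open B9SectCLatticeCarrier (Bond)
open B9Eq311L2Pairing (WL2)
open B11Eq115Space (NegSize Space115 JetSup NegSup)
open B11Eq103H1Complex (SiteL2K BondL2K greenK_apply)
open Summit.QuantumFields.YangMills.Theorems.Prop7SectET3Transport (periodsT3 bondEquiv bgOfCfg)
open Summit.QuantumFields.YangMills.Theorems.Prop7SectET3HilbertLetters (W₂ frobEquiv toL2 toL2B QL2 DL2 DstarL2 covLapSite)
open Summit.QuantumFields.YangMills.Theorems.Prop7SectET3GaugeProjector (QDS NS RS mem_NS_iff RS_apply_covLapSite_of_mem)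
open Summit.QuantumFields.YangMills.Theorems.Prop7SectET3CurvedPropagators (PosOnto GT frakGT frakGfR Qk Qk_GT_DL2_RS Qk_frakGT QTwS_iota_frakGfR)
open Summit.QuantumFields.YangMills.Theorems.Prop7SymAvgTwSym (QTwS)

variable {F : T3Family} {n K : ℕ} {h : n ≤ K} {c₀ cB a : ℝ} [Fact (0 < c₀)] [Fact (0 < cB)]

/-- `Δ′_aλ = Δ^ηλ` for `λ ∈ N_S` (the `Q′*aQ′` term vanishes on `ker Q′`). [cite: Balaban1985BackgroundPropagators, (3.24) p.394] -/
theorem laplacePrimeA_apply_of_mem_NS (U₀ : GaugeField (F.P K) 0 (Matrix.specialUnitaryGroup (Fin 2) ℂ)) {l : SiteL2K ℂ 3 (periodsT3 F K) c₀ W₂}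
    (hl : l ∈ NS F n K h c₀ cB U₀) : laplacePrimeA F n K h c₀ cB a U₀ l = covLapSite F n K c₀ U₀ l := by
  have h0 : QDS F n K h c₀ cB U₀ l = 0 := LinearMap.mem_ker.1 hl
  simp only [laplacePrimeA, LinearMap.add_apply, LinearMap.smul_apply, LinearMap.comp_apply, h0, map_zero, smul_zero, add_zero]

/-- **`G′(Δ^ηλ) = λ` for `λ ∈ N_S`, ON THE CLASS** — print's «RD*Dλ = Δλ … λ ∈ N(Q′)» step, inverted. [cite: Balaban1985BackgroundPropagators, (3.118) p.419, (3.25) p.394] -/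
theorem GprimeT_covLapSite_of_mem_NS {U₀ : GaugeField (F.P K) 0 (Matrix.specialUnitaryGroup (Fin 2) ℂ)} (hq : PosPrime F n K h c₀ cB a U₀)
    {l : SiteL2K ℂ 3 (periodsT3 F K) c₀ W₂} (hl : l ∈ NS F n K h c₀ cB U₀) : GprimeT F n K h c₀ cB a U₀ (covLapSite F n K c₀ U₀ l) = l := by
  rw [← laplacePrimeA_apply_of_mem_NS (a := a) U₀ hl, GprimeT_of_pos hq]
  exact greenK_apply hq.pos l

/-- ★ **THE GAUGE INVARIANCE OF `A ↦ A − DG′R_SD*A` ON THE RESIDUAL ALGEBRA: `(1 − DG′R_SD*)(D_{U₀}λ) = 0` for `λ ∈ N_S(U₀)`** (p. 419 «the expression A − DG′RD*A has this invariance property»), on the class.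
[cite: Balaban1985BackgroundPropagators, (3.118)–(3.119) p.419] -/
theorem gaugeCorr_DL2_of_mem_NS {U₀ : GaugeField (F.P K) 0 (Matrix.specialUnitaryGroup (Fin 2) ℂ)} (hq : PosPrime F n K h c₀ cB a U₀)
    {l : SiteL2K ℂ 3 (periodsT3 F K) c₀ W₂} (hl : l ∈ NS F n K h c₀ cB U₀) : gaugeCorr F n K h c₀ cB a U₀ (DL2 F n K c₀ U₀ l) = 0 := by
  rw [gaugeCorr_apply]
  -- `D*Dλ = Δ^ηλ` (rfl), `R_S` fixes it, `G′` inverts it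
  show DL2 F n K c₀ U₀ l - DL2 F n K c₀ U₀ (GprimeT F n K h c₀ cB a U₀ (RS F n K h c₀ cB U₀ (covLapSite F n K c₀ U₀ l))) = 0
  rw [RS_apply_covLapSite_of_mem U₀ hl, GprimeT_covLapSite_of_mem_NS hq hl, sub_self]

/-- ★★ **`Δ_π(U₀)(D_{U₀}λ) = 0` FOR `λ ∈ N_S(U₀)`** («The quadratic form is invariant with respect to gauge transformations determined by λ ∈ N(Q′)», (3.119)), on the class `PosPrime`.
[cite: Balaban1985BackgroundPropagators, (3.119) p.419] -/
theorem DeltaPi_DL2_of_mem_NS {U₀ : GaugeField (F.P K) 0 (Matrix.specialUnitaryGroup (Fin 2) ℂ)} (hq : PosPrime F n K h c₀ cB a U₀)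
    {l : SiteL2K ℂ 3 (periodsT3 F K) c₀ W₂} (hl : l ∈ NS F n K h c₀ cB U₀) : DeltaPi F n K h c₀ cB a U₀ (DL2 F n K c₀ U₀ l) = 0 := by
  rw [DeltaPi_apply, gaugeCorr_DL2_of_mem_NS hq hl, map_zero, map_zero]

/-- **THE HYPOTHESIS `hΔ` OF THE (3.124) ROWS, DISCHARGED FOR `Δx := DeltaPiSlot`.** [cite: Balaban1985BackgroundPropagators, (3.119) p.419, (3.124) p.420] -/
theorem DeltaPiSlot_kills_NS {U₀ : GaugeField (F.P K) 0 (Matrix.specialUnitaryGroup (Fin 2) ℂ)} (hq : PosPrime F n K h c₀ cB a U₀) :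
    ∀ l ∈ NS F n K h c₀ cB U₀, DeltaPiSlot F n K h c₀ cB a U₀ (DL2 F n K c₀ U₀ l) = 0 :=
  fun _ hl => DeltaPi_DL2_of_mem_NS hq hl

/-- ★★ **(3.124)₂ FOR PRINT'S `G = (Δ_π + DRD* + Q*aQ)⁻¹`: `Q_k G D R_S = 0`**, modulo the two positivity classes only. [cite: Balaban1985BackgroundPropagators, (3.124) p.420] -/
theorem Qk_Gpi_DL2_RS {U₀ : GaugeField (F.P K) 0 (Matrix.specialUnitaryGroup (Fin 2) ℂ)} (hp : PosOnto F n K h c₀ cB a (DeltaPiSlot F n K h c₀ cB a) U₀)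
    (hq : PosPrime F n K h c₀ cB a U₀) (s : SiteL2K ℂ 3 (periodsT3 F K) c₀ W₂) :
    Qk F n K h c₀ cB U₀ (Gpi F n K h c₀ cB a U₀ (DL2 F n K c₀ U₀ (RS F n K h c₀ cB U₀ s))) = 0 :=
  Qk_GT_DL2_RS hp (DeltaPiSlot_kills_NS hq) s

/-- ★★ **«`Q𝔊 = 0`» FOR `𝔊 = G𝔓*` AT PRINT'S `G` (3.122)**, Hilbert level, modulo the two positivity classes only. [cite: Balaban1985Variational, (102) p.293; Balaban1985BackgroundPropagators, (3.147) p.425] -/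
theorem Qk_frakGT_pi {U₀ : GaugeField (F.P K) 0 (Matrix.specialUnitaryGroup (Fin 2) ℂ)} (hp : PosOnto F n K h c₀ cB a (DeltaPiSlot F n K h c₀ cB a) U₀)
    (hq : PosPrime F n K h c₀ cB a U₀) (x : BondL2K ℂ 3 (periodsT3 F K) c₀ W₂) :
    Qk F n K h c₀ cB U₀ (frakGT F n K h c₀ cB a (DeltaPiSlot F n K h c₀ cB a) U₀ x) = 0 :=
  Qk_frakGT hp (DeltaPiSlot_kills_NS hq) x

/-- ★★★ **THE EX BINDER `h102` VERBATIM (with `QTwS`) FOR THE READER OF RECORD AT PRINT'S `G`: `QTwS U₀ (ι(𝒢f f)) = 0`, `𝒢f := frakGfR … DeltaPiSlot U₀`**, modulo `PosOnto ∧ PosPrime` — the N06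
positivity inputs — ONLY. [cite: Balaban1985Variational, (102) p.293; Balaban1985BackgroundPropagators, (3.119) p.419, (3.124) p.420] -/
theorem QTwS_iota_frakGfR_pi [Fact (0 < (F.L : ℝ))] [Fact (0 < ((F.L : ℝ)⁻¹) ^ (K - n))] {U₀ : GaugeField (F.P K) 0 (Matrix.specialUnitaryGroup (Fin 2) ℂ)}
    (hp : PosOnto F n K h c₀ cB a (DeltaPiSlot F n K h c₀ cB a) U₀) (hq : PosPrime F n K h c₀ cB a U₀)
    (f : NegSize (F.L : ℝ) (((F.L : ℝ)⁻¹) ^ (K - n)) (fun _ : Bond 3 (periodsT3 F K) => K - n) 3 (Matrix (Fin 2) (Fin 2) ℂ)) :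
    QTwS F n K h U₀ (fun b : PBond (F.P K) 0 => JetSup.equiv _ _ _ (frakGfR F n K h c₀ cB a (DeltaPiSlot F n K h c₀ cB a) U₀ f) (bondEquiv F K b)) = 0 :=
  QTwS_iota_frakGfR hp (DeltaPiSlot_kills_NS hq) f

end Summit.QuantumFields.YangMills.Theorems.Prop7SectET3DeltaPi

end
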